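import Mathlib
import HarnessLib
import HarnessLib.Audit
import Summits.ValiantsHypothesis.Statement
import Literature.Computability.AlgebraicComplexity.DeterminantalComplexity
import HarnessLib.Audit.Status.Attr

/-!
Route: FermionicJet

CLOSED (superseded) 2026-08-27T17:19:43Z by planner-tenure-valiant-dormant-sweep-g1-0 — reason: superseded:route-ValiantsHypothesis-TwistedDetRank — superseded by route-ValiantsHypothesis-TwistedDetRank — note: census (tenure g1, director-valiant g8 D2 16:23:56Z / order 16:44:00Z): stmt-5342 HcProjectsToCdet PROVED (p547591, Theorems hcProjectsToCdet_proof; helper p546619) ⇒ by the route's own calibration FirstOrderHardness (stmt-5341, cdet ∉ VP_ℂ) ⟺ VH and BoundedOrderHardness (stmt-5340) ⇐ 5341 via First. The file is kept as the record of this route; refuted decls are indexed as negative knowledge (`ledger negatives`).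

# Route FermionicJet — det is an isolated easy point — a fixed-order jet of det(I+ZX)^t at t=1 is
hard, first the cycle-counting determinant cdet

Put c(σ) = number of cycles of σ (fixed points included) and F_n(t) := Σ_σ sgn(σ) t^{c(σ)} Π_i X(σ
i, i) = [z_1⋯z_n] det(I + ZX)^t,
the fermionic (cycle-fugacity) pencil: t = 1 is det_n, t = −1 is (−1)^n per_n (MacMahon), rational t
∉ {0,1} is VNP-complete
(de Rugy-Altherre). Expand at the free-fermion point: F_n(1+ε) = Σ_k ε^k f_{n,k} with the JETS
f_{n,k} = Σ_σ sgn(σ)·C(c(σ),k)·x^σ,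
f_{n,0} = det_n, f_{n,1} = cdet_n := Σ_σ sgn(σ) c(σ) x^σ = Σ_S ±HC(X_S)·det(X_{S^c}). Every f_{·,k}
is a VNP family, so
X (BOUNDED-ORDER HARDNESS) := "for some fixed order k the jet family (f_{n,k})_n is not in VP over
ℂ" suffices for VP ≠ VNP.
The jets form a chain f_k ≤_p f_{k+1} (support JetChain), so the first hard order is a threshold and
the sharpest bet is the
rank-2 crux FIRST-ORDER HARDNESS: cdet ∉ VP. Realises card fermionic-pencil-first-order (and the
slogan of the retired
det-unique-integrable-point card it absorbed).
Lean: `∃ k : ℕ, ¬ Literature.Computability.AlgebraicComplexity.IsVPFamily (k := ℂ) (fun n => ∑ σ :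
Equiv.Perm (Fin n), MvPolynomial.C ((((Equiv.Perm.sign σ : ℤ) * (Nat.choose (Multiset.card
σ.cycleType + (Finset.univ.filter (fun i => σ i = i)).card) k : ℕ)) : ℤ) : ℂ) * ∏ i, (MvPolynomial.X
(σ i, i) : MvPolynomial (Fin n × Fin n) ℂ))`

## Assembly
Pure bookkeeping, sorry-free in the planner's Sketch.lean (assembly_holds): if VP ℂ = VNP ℂ then for
the k given by X the bundled jet
family lies in VNP ℂ = VP ℂ (JetsInVNP + mem_VNP_ofFintype_iff_holds), hence is a VP family
(mem_VP_ofFintype_iff_holds), contradicting X.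
No hub through per is needed. The rank-2 crux enters through FirstToBounded (k = 1).

Rationale: WHY THIS LINE. It is perturbation theory at the one point of VNP we understand: on the explicit
rational curve t ↦ F_n(t) inside VNP the determinant
is an ISOLATED easy point (DeRugyAltherre2013 Thm 1: VNP-complete for every rational t ∉ {0,1};
MertensMoore2013: #P-hard for k ≥ 3,
⊕P-hard for k = 2; Curticapean2021 and Bläser–Dell doi:10.1007/978-3-540-73420-8_69 are the immanant
/ cover-polynomial shadows), so
VP ≠ VNP becomes "easiness does not deform to first order along the pencil" and the target is a
concrete degree-n polynomial in the
same n² variables as det_n, one t-derivative away from it: cdet = [z^{[n]}] det(I+ZX)·tr log(I+ZX).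
Imported: a physics dictionary that
is exact, not an analogy (t = fermion coupling; t = ±k are Chandrasekharan–Wiese fermionants /
bosonic colouring partition functions;
the (m²+1)-variable pencil polynomial is the object of the exponential-time algorithms of
Björklund–Kaski–Williams
BjorklundKaskiWilliams2018), deformation/jet calculus (the Leibniz rule F_t(A ⊕ B) = F_t(A)F_t(B)
drives the new JetChain lemma
f_k(X) = f_{k+1}(X ⊕ K) with an explicit constant fan matrix K), and the Mignon–Ressayre Hessian
geometry for the first quantitative
separation of cdet from det. What no prior route or card does: all open routes bound per_n (DetQP,
GCTMult, IntegralGCT, Depth4) or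
transfer from other conjectures (TauConst, BoolTransfer, Elusive); this one replaces the permanent
by the tangent vector of the pencil
at det, records that the unsigned tangent (cper, at the bosonic point) is VNP-complete by a 2×2
block while the signed one resists the
copies+iff-gadget amplification (its weight is additive), and asks the completeness question with a
simple-pole interpretation.

RANKED CRUXES. #0 BoundedOrderHardness (target) — X — for some fixed order k, the k-th Taylor
coefficient family f_{n,k} = Σ_σ sgn(σ) C(c(σ),k) x^σ of the fermionic pencil at t = 1 is not a VP
family over ℂ (card: "VH ⟺ some Taylor coefficient at the free-fermion point is hard", made uniform
in k). (why it might fail: every FIXED-order jet may lie in VP with size n^{O(k)} (a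
Curticapean-type threshold in the jet order, hardness only at k ≥ n^δ): then the pencil is hard
(dRA) but no fixed jet is, and X is false with VH open.) [DeRugyAltherre2013, Curticapean2021,
MertensMoore2013]
#2 FirstOrderHardness (crux) — the cycle-counting determinant cdet_n = Σ_σ sgn(σ) c(σ) Π_i X(σ i, i)
= d/dt|_{t=1} [z^{[n]}] det(I+ZX)^t is not a VP family over ℂ (card crux rank 2; by JetChain it
implies hardness of every fixed-order jet, by FirstToBounded it gives X). [difficulty: open-problem]
(why it might fail: cdet may be in VP: it is the t-derivative AT the easy point, every statistic
sgn·g(c_1) is easy (det(X+(u−1)diag X)), cdet = multilinear part of adj(I+ZX)·(I+ZX)log(I+ZX) pairs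
two VP objects, and no bound either way on Σ sgn·c·x^σ is in print.) [DeRugyAltherre2013,
MertensMoore2013, Curticapean2021, BjorklundKaskiWilliams2018]
#3 HcProjectsToCdet (crux) — HC_n is a p-projection of cdet (hence cdet is VNP-complete under
p-projections and FirstOrderHardness ⟺ VH); the card's "status of cdet" crux. A proof must break the
sign with the cycle count: for the UNSIGNED jet cper = Σ c(σ)x^σ the 2×2 block K = [[1,1],[1,−1]]
(per K = 0, cper K = −1) already gives per(X) = −cper(X ⊕ K), while for cdet the same move returns
det. [difficulty: L] (why it might fail: c(σ) is ADDITIVE over blocks (cdet(A⊕B) = cdet A·det B +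
det A·cdet B), so dRA's ℓ-copies + iff-gadget interpolation yields only ℓ·cdet + β·det; completeness
needs a reduction with a SIMPLE pole at t = 1 — cdet may be VNP-intermediate or complete only under
c-reductions.) [DeRugyAltherre2013, Burgisser2000, MertensMoore2013]
#4 QuadraticDcCdet (crux) — Mignon–Ressayre-size separation of the first jet from det: n² ≤
2·dc(cdet_n) for all n ≥ 3 (dc(det_n) = n). By the PROVED cone fact rank Hess_x(f) ≤ 2·dc(f) at
zeros x of f
(Literature.Computability.AlgebraicComplexity.rank_hessianMatrix_le_two_mul_determinantalComplexity)
it suffices to exhibit, uniformly in n, a zero of cdet_n whose n²×n² Hessian is nonsingular;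
exact-rational numerics (planner, scratch/hess_cdet.py): rank n² at random zeros for n = 3, 4, 5
(det: 2n; per: n²). [difficulty: M] (why it might fail: needs an EXPLICIT zero of cdet_n with
nonsingular Hessian for every n ≥ 3 (MR's block point for per does not transfer: cdet is only
conjugation-symmetric); n = 3 also has rank-8 zeros, and a uniform family may force an ∃ n₀
restatement.) [MignonRessayre2004, arXiv:2202.13016, Landsberg2017]
#9 JetsInVNP (support) — every fixed-order jet family f_{·,k} is in VNP over ℂ (Valiant's criterion:
the coefficient sgn(σ)·C(c(σ),k) is computed from the permutation matrix E by VP polynomials — det E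
for the sign, c(E) = Σ_i Σ_j (1/j)(E^j)_{ii} Π_{l<j}(1 − (E^l)_{ii}) for the cycle count — times the
permutation-matrix recogniser of HamiltonianCycleVNP.lean). Needed by the Assembly. [difficulty: M]
[Burgisser2000, Valiant1979]
#9 FirstToBounded (support) — glue — FirstOrderHardness is the k = 1 instance of X (C(c,1) = c); one
line, sorry-free in the planner's Sketch.lean. [difficulty: provable-now] [DeRugyAltherre2013]
#9 JetChain (support) — the jets form a chain under p-projections: f_k is a projection of f_{k+1} in
n + k + 2 variables' worth of matrix, via f_k(X) = f_{k+1}(X ⊕ K) for the constant (k+2)×(k+2) "fan"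
matrix K with F_K(t) = (t−1) + (−1)^k (t−1)^{k+2} (Leibniz rule F_t(A⊕B) = F_t(A)F_t(B) ⇒ jets
convolve; f_0(K) = 0, f_1(K) = 1, f_j(K) = 0 for 2 ≤ j ≤ k+1). Hence easiness propagates down the
order, hardness up, and the first hard order is a threshold. Verified by exact computation for k ≤
2, n ≤ 3 (scratch/check_ids.py). [difficulty: M] [DeRugyAltherre2013, Burgisser2000]
#9 PencilEndpoints (support) — the two integrable points of the pencil: F_n(1) = det_n and F_n(−1) =
(−1)^n per_n (Ferm^1 = det, Ferm^{−1} = per; MacMahon / Vere-Jones α-determinant at α = −1). Grounds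
the objects against the tree's detPoly / perPoly conventions (Π_i X(σ i, i)). Verified for n ≤ 4 by
exact computation. [difficulty: provable-now] [DeRugyAltherre2013, MertensMoore2013,
MatsumotoWakayama2006]
#9 MarkedCycleExpansion (support) — the marked-cycle (Hadamard-pairing) normal form of the first
jet: cdet_n = Σ_i X(i,i)·det(X_{{i}ᶜ}) + Σ_{|S| ≥ 2} (−1)^{|S|−1} HC(X_S)·det(X_{Sᶜ}) ("a
Hamiltonian cycle dressed by a determinant"; = [z^{[n]}] det(I+ZX)·tr log(I+ZX); the |S| = 1 term is
separate because the tree's HC vanishes on one vertex). Group σ by a marked cycle. Verified for n ≤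
5 by exact computation. [difficulty: provable-now] [DeRugyAltherre2013, Burgisser2000]
#9 PencilControlsHC (support) — the pencil with t an extra variable (the (n²+1)-variable fermionant
polynomial of Björklund–Kaski–Williams) in VP would put HC_n in VP, because [t^1] F_n = (−1)^{n−1}
HC_n and extracting a t-coefficient costs a factor O(n²) (interpolation at n+1 points). With the
proved VNP-completeness of HC (isVNPComplete_hcPoly_holds) this is the tree's form of "VH ⟹ the
pencil, hence some Taylor coefficient, is hard"; the interpolation lemma it needs is reusable
infrastructure. [difficulty: M] [BjorklundKaskiWilliams2018, Burgisser2000, DeRugyAltherre2013]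

TWO-LAYER PLAN. Foreseen glued splits once a crux moves (none filed now): HcProjectsToCdet ⇐
SignBreakingGadget (a constant gadget family whose lifts of a
logical cycle cover have total weight Σ sgn·c independent of the cover's parity) →
GadgetInterpolation → HcProjectsToCdet;
QuadraticDcCdet ⇐ ExplicitZeroFamily (a closed-form zero x_n of cdet_n for every n ≥ 3) →
HessianNonsingular (det Hess_{x_n} cdet_n ≠ 0)
→ QuadraticDcCdet; FirstOrderHardness ⇐ restricted models first (cdet ∉ VBP / formulas / homogeneous
ΣΠΣΠ via measures that are NOT
functions of flattening ranks) as layer-2 children, the general statement staying rank 2.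

KILL CRITERIA. FirstOrderHardness refuted (poly-size circuits, or a poly-size determinantal/ABP
expression for cdet_n) does NOT close the route: by
JetChain the thesis moves one order up — restate rank 2 as SecondOrderHardness (f_{n,2} = Σ
sgn·C(c,2)·x^σ ∉ VP) and record cdet ∈ VP as
a theorem about det's first-order rigidity failing. The route closes `refuted:BoundedOrderHardness`
if ALL fixed-order jets are shown to
be in VP (a uniform n^{g(k)} algorithm) — itself a striking threshold theorem to be filed as
negative knowledge. HcProjectsToCdet proved
⇒ rank 2 ⟺ VH: keep the route as a normal-form route (re-rank QuadraticDcCdet and restricted-model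
children up). QuadraticDcCdet refuted
(Hessian of cdet_n degenerate on its hypersurface for infinitely many n) ⇒ strong evidence cdet is
det-like ⇒ pivot to f_2 at once.
VP ≠ VNP proved on any other route moots everything here except JetChain / HcProjectsToCdet as
structure theory.

NOT DECOMPOSED YET. The counting shadow (GapP/#P-hardness of cdet on 0/1 matrices under Turing
reductions — no Boolean-oracle typing attempted), the
c-reduction form of completeness (no algebraic oracle circuits in the tree), individual jets k ≥ 2,
restricted-model lower bounds for
cdet (first compute its flattening ranks: sgn·c is not multiplicative, so they need not equal det's
C(n,k)²), the transcendental-coupling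
genericity statement of the card (superseded by DeRugyAltherre2013 Thm 1, dropped), and the
α-determinant representation theory
(Matsumoto–Wakayama MatsumotoWakayama2006: the cyclic U(gl_n)-module of det^{(α)} degenerates
exactly at the content zeros) as a source of
equations for the jets — all layer-2 or later.

CHEAPEST FALSIFIER. (i) Small-circuit search for cdet: compute for n ≤ 7 the flattening
(partial-derivative) ranks and Nisan coefficient-matrix ranks of
cdet_n next to det_n (C(n,k)²) and per_n — a det-like profile everywhere would make
FirstOrderHardness suspect, a per-like one supports it
(kit job, minutes). (ii) Already run by the planner (exact rationals, scratch/hess_cdet.py): Hessian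
rank at random zeros — det_n: 2n;
per_n: n²; cdet_n: 9, 16, 25 for n = 3, 4, 5 — cdet passed the only geometric test that separates
per from det. (iii) Lookup: any
complexity statement on Σ_σ sgn(σ)c(σ)x^σ, i.e. on ∂_t of the fermionant / α-determinant at the free
point — zbMATH / Crossref queries
below found none; the refuter novelty audit of the card found none either.

NUMBERS. dc(det_n) = n; dc(per_n) ≥ n²/2 (MignonRessayre2004; tree:
sq_le_two_mul_determinantalComplexity_perPoly_complex_holds); Hessian ranks on
the hypersurface measured here: det 6/8/10, per 9/16/25, cdet 9/16/25, f_2 8/16/25, Ferm_2 9/16/25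
at n = 3/4/5. Pencil: Ferm^k VNP-complete
(c-reductions) for rational k ∉ {0,1} (DeRugyAltherre2013 Thm 1), #P-hard for k ≥ 3 and ⊕P-hard for
k = 2 (MertensMoore2013); fastest
evaluation of a fermionant 2^m·poly(m), 2^{m−Ω(·)} over suitable finite fields
(BjorklundKaskiWilliams2018 §4). cdet_2 = 2x₁₁x₂₂ − x₁₂x₂₁;
JetChain matrices: K_{det←cdet} = [[1,1],[1,1]], size k+2 in general. Items at open: 11 (1 target, 3
cruxes, 6 support, 1 assembly).

DEFINITION REQUESTS. To be filed right after open (inline sums are used meanwhile, so every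
statement elaborates today): `numCycles` (cycles of a
permutation incl. fixed points), `fermionicPencil n t` = Σ sgn·t^{c}·Π X(σ i,i) and `cycleJet n k` =
Σ sgn·C(c,k)·Π X(σ i,i) (cdet = cycleJet n 1)
in Literature/Computability/AlgebraicComplexity, with the bridges pencil 1 = detPoly, pencil (−1) =
(−1)^n perPoly. No cite facts are
needed as hypotheses: dRA Thm 1 is motivation only; the assembly rests on proved cone facts
(mem_VP/VNP_ofFintype_iff_holds) and JetsInVNP.

Novelty: Searches (2026-08-15): `lit frontier ValiantsHypothesis --since 2020` (30 rows; one pencil-adjacent: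
arXiv:2604.28019 symmetrized
determinant, read, unrelated object); `lit bridges ValiantsHypothesis --cross any` (30 rows, none on
cycle-weight pencils);
`lit search --source zbmath "fermionant complexity determinant permanent number of cycles"` (3:
arXiv:1110.1821, BjorklundKaskiWilliams2018,
doi:10.4230/lipics.ipec.2017.6 — read BKW: algorithms only); `lit search --source zbmath|crossref
"alpha-determinant cyclic module number of
cycles permutation"` (zbmath 1: MatsumotoWakayama2006; crossref 7, none on complexity); `lit search
--source zbmath "weighted sum over
permutations sign number of cycles polynomial circuit"` (1, irrelevant); `lit read arxiv:1309.2156`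
pp. 2–6 (Thm 1, Lemma 1, Vandermonde
degenerating at k = ±1, conclusion p. 6); local searchd down (rc reset) and `lit galaxy search
"alpha-determinant" / "fermionant" --star
all|pdf|panama` saturated or 0 hits at filing; OpenAlex/arXiv APIs rate-limited (429). Plus the
card's refuter audit (dRA, MM, Curticapean,
Bläser–Dell, Vere-Jones, Matsumoto–Wakayama).
Nearest prior art found: DeRugyAltherre2013 (arXiv:1309.2156) Thm 1 — the pencil dichotomy at
rational couplings, with the slogan "det is
really special" (p. 6); MertensMoore2013 (arXiv:1110.1821) — counting hardness of fermionants;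
Curticapean2021 (arXiv:2102.04340) —
immanant dichotomy; BjorklundKaskiWilliams2018 — the pencil as an (m²+1)-variable polynomial, 2^m-t  [refs: 10.4230/lipics.ipec.2017.6, 2604.28019, 1110.1821, 1309.2156, 2102.04340, doi:10.4230/lipics.ipec.2017.6, arxiv:1309.2156, BjorklundKaskiWilliams2018, MatsumotoWakayama2006, DeRugyAltherre2013, MertensMoore2013, Curticapean2021]

Barriers (technique_class: deformation-pencil, perturbative-jets, completeness): - technique_class: deformation-pencil, perturbative-jets, completeness
- Literature.Barriers.ValiantsHypothesis.PartialDerivativesDetPerm: its proof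
(finrank_span_derivSet_permSum) needs a MULTIPLICATIVE coefficient function c(πτ) = c(π)c(τ); sgn·c
is additive-times-sign, so cdet's flattening ranks are not forced to coincide with det's — but no
flattening bound against VP exists anyway; QuadraticDcCdet uses the Hessian on the hypersurface (MR,
which separates per from det), not flattenings; the same concession covers the uncatalogued
rank-method / shifted-partials no-go results (any measure-based child must separate cdet from det
although cdet = ∂_t of a det-power generating function) and the characteristic-2 collapse (t ≡ −t:
det = per, cdet ≡ Σ_{c odd} x^σ — every statement here is over ℂ and uses signs essentially; nothing
is characteristic-free).
- Literature.Barriers.ValiantsHypothesis.AlgebraicNaturalProofs: it does not bite a priori — no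
VP-natural distinguisher is proposed, and cdet has small integer coefficients; it gives no help
either; the bet is structural (completeness / jet calculus), not a distinguisher.
- Literature.Barriers.ValiantsHypothesis.DepthReductionChasm: touches only the foreseen
restricted-model children of FirstOrderHardness (homogeneous depth-4 bounds for cdet are capped at
n^{O(√n)} by the chasm like everyone's); the filed statements make no depth-4 claim.
- Literature.Barriers.ValiantsHypothesis.GCTOccurrenceObstructions: not engaged; remark onl

Novelty grade: new-combination — refuter route-review grade (2026-08-15; my live legs: zbMATH 'fermionant' (4 hits: MertensMoore2013, BKW ×2, DeRugyAltherre2013), 'alpha-permanent complexity' (Crane 2013 identities, Wang–Jasra 2016 Monte Carlo), 'sum over permutations sign number of cycles polynomial' (nothing); S2/arXiv/crossref/g (refuter refuter-rreview-route-CriticalPhenomena--c23efa21-0, 2026-08-15T14:02:06Z; prior: DeRugyAltherre2013 (arXiv:1309.2156) Thm 1; MertensMoore2013 (arXiv:1110.1821); MignonRessayre2004; Curticapean2021 (arXiv:2102.04340); BjorklundKaskiWilliams2018; MatsumotoWakayama2006)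

History (route lifecycle, newest last):
- 2026-08-16T04:20:26Z · AUTO-CRUX (backfill): BoundedOrderHardness — hypotheses of the deciding theorem that nothing in the route derives are cruxes (operator:999:1085951)
- 2026-08-22T03:32:00Z · DORMANT — reconciler: no traction for 5 d (last activity item-evidence-added at 2026-08-17T02:16:46Z); parked, not closed — `ledger route dormant route-ValiantsHypothesis (operator:999:513941)
- 2026-08-26T23:14:53Z · REACTIVATED — reconciler: reactivated — activity item-evidence-added at 2026-08-26T22:33:13Z after parking at 2026-08-22T03:32:00Z (operator:999:970284)
- 2026-08-27T17:19:44Z · CLOSED superseded — superseded:route-ValiantsHypothesis-TwistedDetRank (planner-tenure-valiant-dormant-sweep-g1-0)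

sub-problem: ValiantsHypothesis · status: closed(superseded) · opened planner-plancard-ValiantsHypothesis-ValiantsH-b971e64f-0 2026-08-15T11:40:50Z · rev 1 · ledger route-ValiantsHypothesis-FermionicJet
GENERATED by the gate from the ledger (D-0016/17). Provers cite these decls: `theorem foo : Summit.ValiantsHypothesis.ValiantsHypothesis.Theses.FermionicJet.<Decl> := …` in Summits/ValiantsHypothesis/ValiantsHypothesis/Theorems/<Name>.lean.
-/

namespace Summit.ValiantsHypothesis.ValiantsHypothesis.Theses.FermionicJet

open scoped BigOperators Topology Manifold Classical MeasureTheory ProbabilityTheory Matrix InnerProductSpace ComplexConjugate ContinuousMap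
open Filter Set Function TopologicalSpace MeasureTheory

attribute [summit_statement] _root_.ValiantsHypothesis

open Literature.PNP

/-- item stmt-ValiantsHypothesis-5340 · crux (kind.auto-crux: conjecture-grade) · rank 0 · closed · moot by None · by planner
why it might fail: every FIXED-order jet may lie in VP with size n^{O(k)} (a Curticapean-type threshold in the jet order, hardness only at k ≥ n^δ): then the pencil is hard (dRA) but no fixed jet is, and X is false with VH open.
sources: DeRugyAltherre2013, Curticapean2021, MertensMoore2013
[target] X — for some fixed order k, the k-th Taylor coefficient family f_{n,k} = Σ_σ sgn(σ)
C(c(σ),k) x^σ of the fermionic pencil at t = 1 is not a VP family over ℂ (card: "VH ⟺ some Taylor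
coefficient at the free-fermion point is hard", made uniform in k). -/
@[route_item "route-ValiantsHypothesis-FermionicJet", crux]
def BoundedOrderHardness : Prop :=
  ∃ k : ℕ, ¬ Literature.Computability.AlgebraicComplexity.IsVPFamily (k := ℂ) (fun n => ∑ σ : Equiv.Perm (Fin n), MvPolynomial.C ((((Equiv.Perm.sign σ : ℤ) * (Nat.choose (Multiset.card σ.cycleType + (Finset.univ.filter (fun i => σ i = i)).card) k : ℕ)) : ℤ) : ℂ) * ∏ i, (MvPolynomial.X (σ i, i) : MvPolynomial (Fin n × Fin n) ℂ))

/-- item stmt-ValiantsHypothesis-5341 · crux · rank 2 · closed · moot by None · by planner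
why it might fail: cdet may be in VP: it is the t-derivative AT the easy point, every statistic sgn·g(c_1) is easy (det(X+(u−1)diag X)), cdet = multilinear part of adj(I+ZX)·(I+ZX)log(I+ZX) pairs two VP objects, and no bound either way on Σ sgn·c·x^σ is in print.
sources: DeRugyAltherre2013, MertensMoore2013, Curticapean2021, BjorklundKaskiWilliams2018
[crux] the cycle-counting determinant cdet_n = Σ_σ sgn(σ) c(σ) Π_i X(σ i, i) = d/dt|_{t=1} [z^{[n]}]
det(I+ZX)^t is not a VP family over ℂ (card crux rank 2; by JetChain it implies hardness of every
fixed-order jet, by FirstToBounded it gives X). [difficulty: open-problem] -/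
@[route_item "route-ValiantsHypothesis-FermionicJet"]
def FirstOrderHardness : Prop :=
  ¬ Literature.Computability.AlgebraicComplexity.IsVPFamily (k := ℂ) (fun n => ∑ σ : Equiv.Perm (Fin n), MvPolynomial.C ((((Equiv.Perm.sign σ : ℤ) * ((Multiset.card σ.cycleType + (Finset.univ.filter (fun i => σ i = i)).card : ℕ) : ℤ)) : ℤ) : ℂ) * ∏ i, (MvPolynomial.X (σ i, i) : MvPolynomial (Fin n × Fin n) ℂ))

/-- item stmt-ValiantsHypothesis-5342 · crux · rank 3 · closed · proved by Summit.ValiantsHypothesis.ValiantsHypothesis.Theorems.hcProjectsToCdet_proof (prover) · by planner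
why it might fail: c(σ) is ADDITIVE over blocks (cdet(A⊕B) = cdet A·det B + det A·cdet B), so dRA's ℓ-copies + iff-gadget interpolation yields only ℓ·cdet + β·det; completeness needs a reduction with a SIMPLE pole at t = 1 — cdet may be VNP-intermediate or complete only under c-reductions.
sources: DeRugyAltherre2013, Burgisser2000, MertensMoore2013
[crux] HC_n is a p-projection of cdet (hence cdet is VNP-complete under p-projections and
FirstOrderHardness ⟺ VH); the card's "status of cdet" crux. A proof must break the sign with the
cycle count: for the UNSIGNED jet cper = Σ c(σ)x^σ the 2×2 block K = [[1,1],[1,−1]] (per K = 0, cper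
K = −1) already gives per(X) = −cper(X ⊕ K), while for cdet the same move returns det. [difficulty:
L] -/
@[route_item "route-ValiantsHypothesis-FermionicJet"]
def HcProjectsToCdet : Prop :=
  Literature.Computability.AlgebraicComplexity.IsPProjection (k := ℂ) (fun n => Literature.Computability.AlgebraicComplexity.hcPoly (Fin n) ℂ) (fun n => ∑ σ : Equiv.Perm (Fin n), MvPolynomial.C ((((Equiv.Perm.sign σ : ℤ) * ((Multiset.card σ.cycleType + (Finset.univ.filter (fun i => σ i = i)).card : ℕ) : ℤ)) : ℤ) : ℂ) * ∏ i, (MvPolynomial.X (σ i, i) : MvPolynomial (Fin n × Fin n) ℂ))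

-- `HcProjectsToCdet` holds: proved by `Summit.ValiantsHypothesis.ValiantsHypothesis.Theorems.hcProjectsToCdet_proof` (its module imports this route file, so no `_holds` link can be stated here).

/-- item stmt-ValiantsHypothesis-5343 · crux · rank 4 · closed · proved by Summit.ValiantsHypothesis.ValiantsHypothesis.Theorems.FermionicJet.quadraticDcCdet_proof (prover) · by planner
why it might fail: needs an EXPLICIT zero of cdet_n with nonsingular Hessian for every n ≥ 3 (MR's block point for per does not transfer: cdet is only conjugation-symmetric); n = 3 also has rank-8 zeros, and a uniform family may force an ∃ n₀ restatement.
sources: MignonRessayre2004, arXiv:2202.13016, Landsberg2017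
[crux] Mignon–Ressayre-size separation of the first jet from det: n² ≤ 2·dc(cdet_n) for all n ≥ 3
(dc(det_n) = n). By the PROVED cone fact rank Hess_x(f) ≤ 2·dc(f) at zeros x of f
(Literature.Computability.AlgebraicComplexity.rank_hessianMatrix_le_two_mul_determinantalComplexity)
it suffices to exhibit, uniformly in n, a zero of cdet_n whose n²×n² Hessian is nonsingular;
exact-rational numerics (planner, scratch/hess_cdet.py): rank n² at random zeros for n = 3, 4, 5
(det: 2n; per: n²). [difficulty: M] -/
@[route_item "route-ValiantsHypothesis-FermionicJet"]
def QuadraticDcCdet : Prop :=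
  ∀ n ≥ 3, n ^ 2 ≤ 2 * Literature.Computability.AlgebraicComplexity.determinantalComplexity (∑ σ : Equiv.Perm (Fin n), MvPolynomial.C ((((Equiv.Perm.sign σ : ℤ) * ((Multiset.card σ.cycleType + (Finset.univ.filter (fun i => σ i = i)).card : ℕ) : ℤ)) : ℤ) : ℂ) * ∏ i, (MvPolynomial.X (σ i, i) : MvPolynomial (Fin n × Fin n) ℂ))

-- `QuadraticDcCdet` holds: proved by `Summit.ValiantsHypothesis.ValiantsHypothesis.Theorems.FermionicJet.quadraticDcCdet_proof` (its module imports this route file, so no `_holds` link can be stated here).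

/-- item stmt-ValiantsHypothesis-5344 · support · rank 9 · closed · proved by Summit.ValiantsHypothesis.ValiantsHypothesis.Theorems.jetsInVNP_proof @ 3ebfa760f225 (prover) · by planner
sources: Burgisser2000, Valiant1979
[support] every fixed-order jet family f_{·,k} is in VNP over ℂ (Valiant's criterion: the
coefficient sgn(σ)·C(c(σ),k) is computed from the permutation matrix E by VP polynomials — det E for
the sign, c(E) = Σ_i Σ_j (1/j)(E^j)_{ii} Π_{l<j}(1 − (E^l)_{ii}) for the cycle count — times the
permutation-matrix recogniser of HamiltonianCycleVNP.lean). Needed by the Assembly. [difficulty: M] -/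
@[route_item "route-ValiantsHypothesis-FermionicJet", crux]
def JetsInVNP : Prop :=
  ∀ k : ℕ, Literature.Computability.AlgebraicComplexity.IsVNPFamily (k := ℂ) (fun n => ∑ σ : Equiv.Perm (Fin n), MvPolynomial.C ((((Equiv.Perm.sign σ : ℤ) * (Nat.choose (Multiset.card σ.cycleType + (Finset.univ.filter (fun i => σ i = i)).card) k : ℕ)) : ℤ) : ℂ) * ∏ i, (MvPolynomial.X (σ i, i) : MvPolynomial (Fin n × Fin n) ℂ))

-- `JetsInVNP` holds: proved by `Summit.ValiantsHypothesis.ValiantsHypothesis.Theorems.jetsInVNP_proof` @ 3ebfa760f225 (its module imports this route file, so no `_holds` link can be stated here).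

/-- item stmt-ValiantsHypothesis-5345 · support · rank 9 · closed · proved by Summit.ValiantsHypothesis.ValiantsHypothesis.Theorems.FermionicJet.firstToBounded_proof @ 9a1ae8a04fd4 (prover) · by planner
sources: DeRugyAltherre2013
[support] glue — FirstOrderHardness is the k = 1 instance of X (C(c,1) = c); one line, sorry-free in
the planner's Sketch.lean. [difficulty: provable-now] -/
@[route_item "route-ValiantsHypothesis-FermionicJet"]
def FirstToBounded : Prop :=
  FirstOrderHardness → BoundedOrderHardness

-- `FirstToBounded` holds: proved by `Summit.ValiantsHypothesis.ValiantsHypothesis.Theorems.FermionicJet.firstToBounded_proof` @ 9a1ae8a04fd4 (its module imports this route file, so no `_holds` link can be stated here).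

/-- item stmt-ValiantsHypothesis-5346 · support · rank 9 · closed · proved by Summit.ValiantsHypothesis.ValiantsHypothesis.Theorems.jetChain_proof (prover) · by planner
sources: DeRugyAltherre2013, Burgisser2000
[support] the jets form a chain under p-projections: f_k is a projection of f_{k+1} in n + k + 2
variables' worth of matrix, via f_k(X) = f_{k+1}(X ⊕ K) for the constant (k+2)×(k+2) "fan" matrix K
with F_K(t) = (t−1) + (−1)^k (t−1)^{k+2} (Leibniz rule F_t(A⊕B) = F_t(A)F_t(B) ⇒ jets convolve;
f_0(K) = 0, f_1(K) = 1, f_j(K) = 0 for 2 ≤ j ≤ k+1). Hence easiness propagates down the order,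
hardness up, and the first hard order is a threshold. Verified by exact computation for k ≤ 2, n ≤ 3
(scratch/check_ids.py). [difficulty: M] -/
@[route_item "route-ValiantsHypothesis-FermionicJet"]
def JetChain : Prop :=
  ∀ k : ℕ, Literature.Computability.AlgebraicComplexity.IsPProjection (k := ℂ) (fun n => ∑ σ : Equiv.Perm (Fin n), MvPolynomial.C ((((Equiv.Perm.sign σ : ℤ) * (Nat.choose (Multiset.card σ.cycleType + (Finset.univ.filter (fun i => σ i = i)).card) k : ℕ)) : ℤ) : ℂ) * ∏ i, (MvPolynomial.X (σ i, i) : MvPolynomial (Fin n × Fin n) ℂ)) (fun n => ∑ σ : Equiv.Perm (Fin n), MvPolynomial.C ((((Equiv.Perm.sign σ : ℤ) * (Nat.choose (Multiset.card σ.cycleType + (Finset.univ.filter (fun i => σ i = i)).card) (k + 1) : ℕ)) : ℤ) : ℂ) * ∏ i, (MvPolynomial.X (σ i, i) : MvPolynomial (Fin n × Fin n) ℂ))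

-- `JetChain` holds: proved by `Summit.ValiantsHypothesis.ValiantsHypothesis.Theorems.jetChain_proof` (its module imports this route file, so no `_holds` link can be stated here).

/-- item stmt-ValiantsHypothesis-5347 · support · rank 9 · closed · proved by Summit.ValiantsHypothesis.ValiantsHypothesis.Theorems.pencilEndpoints_proof @ ad3bd0339242 (prover) · by planner
sources: DeRugyAltherre2013, MertensMoore2013, MatsumotoWakayama2006
[support] the two integrable points of the pencil: F_n(1) = det_n and F_n(−1) = (−1)^n per_n (Ferm^1
= det, Ferm^{−1} = per; MacMahon / Vere-Jones α-determinant at α = −1). Grounds the objects against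
the tree's detPoly / perPoly conventions (Π_i X(σ i, i)). Verified for n ≤ 4 by exact computation.
[difficulty: provable-now] -/
@[route_item "route-ValiantsHypothesis-FermionicJet"]
def PencilEndpoints : Prop :=
  ∀ n : ℕ, (fun t : ℂ => ∑ σ : Equiv.Perm (Fin n), MvPolynomial.C (((Equiv.Perm.sign σ : ℤ) : ℂ) * t ^ (Multiset.card σ.cycleType + (Finset.univ.filter (fun i => σ i = i)).card)) * ∏ i, (MvPolynomial.X (σ i, i) : MvPolynomial (Fin n × Fin n) ℂ)) 1 = Literature.Computability.AlgebraicComplexity.detPoly (Fin n) ℂ ∧ (fun t : ℂ => ∑ σ : Equiv.Perm (Fin n), MvPolynomial.C (((Equiv.Perm.sign σ : ℤ) : ℂ) * t ^ (Multiset.card σ.cycleType + (Finset.univ.filter (fun i => σ i = i)).card)) * ∏ i, (MvPolynomial.X (σ i, i) : MvPolynomial (Fin n × Fin n) ℂ)) (-1) = MvPolynomial.C ((-1 : ℂ) ^ n) * Literature.Computability.AlgebraicComplexity.perPoly (Fin n) ℂ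

-- `PencilEndpoints` holds: proved by `Summit.ValiantsHypothesis.ValiantsHypothesis.Theorems.pencilEndpoints_proof` @ ad3bd0339242 (its module imports this route file, so no `_holds` link can be stated here).

/-- item stmt-ValiantsHypothesis-5348 · support · rank 9 · closed · proved by Summit.ValiantsHypothesis.ValiantsHypothesis.Theorems.FermionicJetMarkedCycleExpansion.markedCycleExpansion_proof (prover) · by planner
sources: DeRugyAltherre2013, Burgisser2000
[support] the marked-cycle (Hadamard-pairing) normal form of the first jet: cdet_n = Σ_i
X(i,i)·det(X_{{i}ᶜ}) + Σ_{|S| ≥ 2} (−1)^{|S|−1} HC(X_S)·det(X_{Sᶜ}) ("a Hamiltonian cycle dressed by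
a determinant"; = [z^{[n]}] det(I+ZX)·tr log(I+ZX); the |S| = 1 term is separate because the tree's
HC vanishes on one vertex). Group σ by a marked cycle. Verified for n ≤ 5 by exact computation.
[difficulty: provable-now] -/
@[route_item "route-ValiantsHypothesis-FermionicJet"]
def MarkedCycleExpansion : Prop :=
  ∀ n : ℕ, (∑ σ : Equiv.Perm (Fin n), MvPolynomial.C ((((Equiv.Perm.sign σ : ℤ) * ((Multiset.card σ.cycleType + (Finset.univ.filter (fun i => σ i = i)).card : ℕ) : ℤ)) : ℤ) : ℂ) * ∏ i, (MvPolynomial.X (σ i, i) : MvPolynomial (Fin n × Fin n) ℂ)) = (∑ i : Fin n, MvPolynomial.X (i, i) * MvPolynomial.rename (fun p : ↥(({i} : Finset (Fin n))ᶜ) × ↥(({i} : Finset (Fin n))ᶜ) => ((p.1 : Fin n), (p.2 : Fin n))) (Literature.Computability.AlgebraicComplexity.detPoly ↥(({i} : Finset (Fin n))ᶜ) ℂ)) + ∑ S : Finset (Fin n), (if 2 ≤ S.card then MvPolynomial.C ((-1 : ℂ) ^ (S.card - 1)) * MvPolynomial.rename (fun p : ↥S × ↥S => ((p.1 : Fin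 n), (p.2 : Fin n))) (Literature.Computability.AlgebraicComplexity.hcPoly ↥S ℂ) * MvPolynomial.rename (fun p : ↥(Sᶜ) × ↥(Sᶜ) => ((p.1 : Fin n), (p.2 : Fin n))) (Literature.Computability.AlgebraicComplexity.detPoly ↥(Sᶜ) ℂ) else 0)

-- `MarkedCycleExpansion` holds: proved by `Summit.ValiantsHypothesis.ValiantsHypothesis.Theorems.FermionicJetMarkedCycleExpansion.markedCycleExpansion_proof` (its module imports this route file, so no `_holds` link can be stated here).

/-- item stmt-ValiantsHypothesis-5349 · support · rank 9 · closed · proved by Summit.ValiantsHypothesis.ValiantsHypothesis.Theorems.FermionicJetPencilControlsHC.pencilControlsHC_proof @ e236adbb285d (prover) · by planner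
sources: BjorklundKaskiWilliams2018, Burgisser2000, DeRugyAltherre2013
[support] the pencil with t an extra variable (the (n²+1)-variable fermionant polynomial of
Björklund–Kaski–Williams) in VP would put HC_n in VP, because [t^1] F_n = (−1)^{n−1} HC_n and
extracting a t-coefficient costs a factor O(n²) (interpolation at n+1 points). With the proved
VNP-completeness of HC (isVNPComplete_hcPoly_holds) this is the tree's form of "VH ⟹ the pencil,
hence some Taylor coefficient, is hard"; the interpolation lemma it needs is reusable
infrastructure. [difficulty: M] -/
@[route_item "route-ValiantsHypothesis-FermionicJet"]
def PencilControlsHC : Prop :=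
  Literature.Computability.AlgebraicComplexity.IsVPFamily (k := ℂ) (fun n => ∑ σ : Equiv.Perm (Fin n), MvPolynomial.C (((Equiv.Perm.sign σ : ℤ) : ℂ)) * (MvPolynomial.X none : MvPolynomial (Option (Fin n × Fin n)) ℂ) ^ (Multiset.card σ.cycleType + (Finset.univ.filter (fun i => σ i = i)).card) * ∏ i, (MvPolynomial.X (some (σ i, i)) : MvPolynomial (Option (Fin n × Fin n)) ℂ)) → Literature.Computability.AlgebraicComplexity.IsVPFamily (k := ℂ) (fun n => Literature.Computability.AlgebraicComplexity.hcPoly (Fin n) ℂ)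

-- `PencilControlsHC` holds: proved by `Summit.ValiantsHypothesis.ValiantsHypothesis.Theorems.FermionicJetPencilControlsHC.pencilControlsHC_proof` @ e236adbb285d (its module imports this route file, so no `_holds` link can be stated here).

/-- item stmt-ValiantsHypothesis-5350 · assembly · rank 1 · closed · proved by Summit.ValiantsHypothesis.ValiantsHypothesis.Theorems.FermionicJet.assembly_proof @ 82479abee689 (prover) · by planner
sources: Burgisser2000, Valiant1979
[assembly] BoundedOrderHardness → JetsInVNP → ValiantsHypothesis. -/
@[route_item "route-ValiantsHypothesis-FermionicJet"]
def Assembly : Prop :=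
  BoundedOrderHardness → JetsInVNP → ValiantsHypothesis

-- `Assembly` holds: proved by `Summit.ValiantsHypothesis.ValiantsHypothesis.Theorems.FermionicJet.assembly_proof` @ 82479abee689 (its module imports this route file, so no `_holds` link can be stated here).

/-! D-0027 §2.1 — DECIDING THEOREM (planner-authored via `route open/edit --closes-file`; by planner-rbadge-ValiantsHypothesis-FermionicJet-7270ff2d-g2-0 2026-08-15T16:12:07Z) — ARCHIVED: route closed (superseded) 2026-08-27T17:19:43Z; kept so importers keep building:
its hypotheses are this route's items and its conclusion the sub-problem Statement (glue_lint), and it elaborates with this file. -/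

@[closes "route-ValiantsHypothesis-FermionicJet"] theorem closes (h_BoundedOrderHardness : BoundedOrderHardness) (h_JetsInVNP : JetsInVNP) :
    _root_.ValiantsHypothesis := by
  show Literature.Computability.AlgebraicComplexity.VP ℂ ≠
    Literature.Computability.AlgebraicComplexity.VNP ℂ
  intro hEq
  obtain ⟨m, hm⟩ := h_BoundedOrderHardness
  apply hm
  have hVNP :=
    (Literature.Computability.AlgebraicComplexity.mem_VNP_ofFintype_iff_holds _).2 (h_JetsInVNP m)
  rw [← hEq] at hVNP
  exact (Literature.Computability.AlgebraicComplexity.mem_VP_ofFintype_iff_holds _).1 hVNP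

end Summit.ValiantsHypothesis.ValiantsHypothesis.Theses.FermionicJet
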